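import Mathlib
import Summits.Schanuel.Schanuel.Theses.RecursiveCore
import Literature.Barriers.Schanuel.AlgebraicIndependenceOfLogarithms
import Literature.NumberTheory.Transcendental.SchanuelSectorSplit
import Literature.FieldTheory.TranscendenceDegree.AlgebraicDependenceBookkeeping

/-!
# Birth skeleton (BC3) — crux `RecursiveSchanuel` (item stmt-Schanuel-12193) of route
# `RecursiveCore`; registrar `planner-skel-stmt-Schanuel-12193-0`, 2026-08-17

The crux (Schanuel on the recursive core 𝓡): if `z₁, …, zₙ ∈ ℂ` are `ℚ`-linearly independent and
every `e^{zᵢ}` is algebraic over `ℚ(z₁, …, zₙ)` (a RECURSIVE tuple), then `z₁, …, zₙ` are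
algebraically independent over `ℚ`.

## The line: split the recursive core at the log sector 𝓛 = exp⁻¹(ℚ̄)

The route splits Schanuel at the recursive core 𝓡 (𝓡 free + Schanuel relative to 𝓡).  This
skeleton splits the first half, Schanuel ON 𝓡, one level down, at the `ℚ`-subspace
`𝓛 = span_ℚ {z | e^z ∈ ℚ̄} = {z | e^z ∈ ℚ̄}` of logarithms of algebraic numbers (Roy's `𝓛`,
`Literature.Barriers.Schanuel.logQSpan`), which sits inside 𝓡 (support item `LogSectorInside`) and
is strictly smaller (support item `CoreBeyondLogs`).  Two registered stubs:

* `stub_logSector` — `Literature.Barriers.Schanuel.AlgIndepLogarithms` BY NAME (the conjecture of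
  algebraic independence of logarithms of algebraic numbers, Waldschmidt 2005 Conj. 1.1; in tree an
  OPEN registered statement, = `LogPatterns.LogSector`, stmt-Schanuel-4310 / stmt-Schanuel-0083):
  `ℚ`-linearly independent `l₁, …, l_k` with `e^{lᵢ} ∈ ℚ̄` are algebraically independent.  This is
  the INSIDE count of the split: the crux restricted to tuples from 𝓛 (every tuple of logarithms of
  algebraic numbers is recursive).
* `stub_offLogRecursive` — `OffLogRecursive` (NEW statement, the OUTSIDE count; recursive Schanuel
  RELATIVE to the log sector, in the tuple form of the route's own `OffRecursiveSchanuel` with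
  (𝓡, recursive `v`) replaced by (𝓛, logarithms `l`)): for logarithms of algebraic numbers
  `l₁, …, l_k` (no independence assumed) and `w₁, …, w_m` linearly independent over `ℚ` MODULO 𝓛
  such that every `e^{w_j}` is algebraic over `ℚ(l, w)`,
  `trdeg_ℚ ℚ(l, w) ≥ trdeg_ℚ ℚ(l) + m`.
  Instances: `k = 0, m = 1` is elementary (proved below, `offLogRecursive_zero_one`: a number
  outside 𝓛 whose exponential is algebraic over itself is transcendental); `k = 0, m = 2` contains
  the algebraic independence of a non-real fixed point `z₀ = e^{z₀}` and its conjugate (open);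
  `k = 1, m = 1` with `l = iπ`, `w = z₀` is `π ⊥ z₀` (open).  No transcendence method treats
  self-referential tuples; the statement is a consequence of the crux and of Schanuel.

Composition (`recursiveSchanuel_of_parts`, sorry-free — the `GL_n(ℚ)` ADAPTED-BASIS ENGINE along
𝓛: Kirby's bookkeeping, Kirby2010EAEF Prop. 7.2 / §1, in tree for Schanuel itself as
`Literature.NumberTheory.Transcendental.schanuel_of_sector_split_set` (`SchanuelSectorSplit.lean`)
and as `SectorGlue.engine` of `Theorems/RigidCoreSchanuelOnLogFreeCoreSectorGlue.lean`; here run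
for the RECURSIVE crux, whose conclusion is algebraic independence): given a recursive `ℚ`-free
`x ∈ ℂⁿ`, put
`V = span_ℚ(x)`, `W = V ⊓ 𝓛` with basis `y` (`k` logarithms of algebraic numbers), `U` a
complement of `W` in `V` with basis `z` (`m` vectors, free modulo 𝓛), `k + m = n`; every `e^{z_j}`
is algebraic over `ℚ(x) = ℚ(y, z)` because `z_j` is a `ℚ`-combination of the `xᵢ` and the
`e^{xᵢ}` are algebraic over `ℚ(x)`; `AlgIndepLogarithms` at `y` gives `k ≤ trdeg ℚ(y)`,
`OffLogRecursive` at `(y, z)` gives `trdeg ℚ(y) + m ≤ trdeg ℚ(y, z) = trdeg ℚ(x)`, so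
`n ≤ trdeg ℚ(x)` and `x` is algebraically independent
(`Literature.Barriers.Schanuel.algebraicIndependent_of_le_trdeg_adjoin`).
`RecursiveSchanuel_of : RecursiveSchanuel` plugs the two stubs into the engine (concludes the crux
BY NAME); the engine `recursiveSchanuel_of_parts : AlgIndepLogarithms → OffLogRecursive → <crux
body>` is the implication form (sorry-free).  The only `sorry`s of the file are the two `stub_*`.

Why this cut: the split is EXACT — `recursiveSchanuel_iff : RecursiveSchanuel ↔ AlgIndepLogarithms ∧
OffLogRecursive` is PROVED below, sorry-free (the crux gives `AlgIndepLogarithms` — support item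
`LogSectorInside` — since tuples of logarithms are recursive, and gives `OffLogRecursive` by
applying it to a `ℚ`-basis `y` of `span l` followed by `w`: `trdeg ℚ(l, w) = trdeg ℚ(y, w) ≥
|y| + m ≥ trdeg ℚ(l) + m`); so neither stub is refutable short of refuting the crux (hence
Schanuel, by the route's support `SplitOfSchanuel`).  NEITHER stub gives the
crux alone (an algebraic dependence between `iπ` and `log 2` would break only `AlgIndepLogarithms`;
an algebraic dependence between a fixed point of `exp` and its conjugate only `OffLogRecursive`),
and the two stubs are the homes of different engines: Baker / linear subgroup theorem (linear
independence only — barrier `AlgebraicIndependenceOfLogarithms`) inside 𝓛, Hermite–Lindemann-type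
self-reference (route crux `RecursiveHermiteLindemann` is its linear shadow) outside 𝓛.
Not chosen: "Schanuel's count for recursive tuples" + bookkeeping (one stub would restate the
crux: costume); a diagonal/coupled case split (not invariant under `GL_n(ℚ)`).

BC3 probes (registrar folder `bc/AlgIndepLogarithms_probe.lean`, `bc/OffLogRecursive_probe.lean`,
`bc/Extra_probe.lean`; stub statements re-declared verbatim, the skeleton NOT imported; record in
`Lines/birth-probes.md`): for each stub `S`, `S → RecursiveSchanuel` and `S → Schanuel` by
`exact?`, `simpa [S]`, `unfold; simpa`, `aesop`, `unfold; aesop`, `first | exact? | simpa | aesop`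
and the BC2 combined form ALL FAIL (17/17 + 17/17 + 20/20 examples error; `exact?` on the raw
Pi-goals times out at whnf even at 4·10⁶ heartbeats, and on the introduced goals answers "could
not close the goal"); dedup `example : S := by exact?` fails; neither stub gives the other.

Disproof used: none relevant — `Cruxes/RecursiveSchanuel/` had no workfiles at registration
(`ledger crux ls stmt-Schanuel-12193`: no Disproof.lean); `ledger negatives --problem Schanuel`
lists only the two PolarPhantoms statements `trdeg ℚ(y, α) < n` (stmt-Schanuel-6844/6846), which
no stub here instantiates (both stubs assert LOWER bounds / independence).
-/

noncomputable section

set_option linter.dupNamespace false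

namespace Summit.Schanuel.Schanuel.Cruxes.RecursiveSchanuel.Birth

open Summit.Schanuel.Schanuel.Theses.RecursiveCore (RecursiveSchanuel)
open Literature.Barriers.Schanuel (AlgIndepLogarithms algebraicIndependent_of_le_trdeg_adjoin)
open Literature.NumberTheory.Transcendental (le_trdeg_adjoin_of_algebraicIndependent'
  isAlgebraic_exp_of_mem_span)
open Literature.FieldTheory.TranscendenceDegree (trdeg_le_card_of_forall_isAlgebraic)
open Complex IntermediateField Submodule Set Function
open Algebra (trdeg)

/-! ## Stub statements -/

/-- OUTSIDE COUNT (open from `m = 2`, resp. `k = m = 1`): recursive Schanuel RELATIVE TO THE LOG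
SECTOR.  For logarithms of algebraic numbers `l₁, …, l_k` and complex numbers `w₁, …, w_m` linearly
independent over `ℚ` modulo `𝓛 = span_ℚ {z | e^z ∈ ℚ̄}`, if every `e^{w_j}` is algebraic over
`ℚ(l, w)` then `trdeg_ℚ ℚ(l) + m ≤ trdeg_ℚ ℚ(l, w)` (adjoining a recursive block free modulo 𝓛
raises the transcendence degree by its full length, whatever the logarithms do). -/
def OffLogRecursive : Prop :=
  ∀ (k m : ℕ) (l : Fin k → ℂ) (w : Fin m → ℂ),
    (∀ i, IsAlgebraic ℚ (Complex.exp (l i))) →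
    LinearIndependent ℚ ((Submodule.span ℚ {z : ℂ | IsAlgebraic ℚ (Complex.exp z)}).mkQ ∘ w) →
    (∀ j, IsAlgebraic (IntermediateField.adjoin ℚ (Set.range l ∪ Set.range w))
      (Complex.exp (w j))) →
    Algebra.trdeg ℚ (IntermediateField.adjoin ℚ (Set.range l)) + (m : Cardinal) ≤
      Algebra.trdeg ℚ (IntermediateField.adjoin ℚ (Set.range l ∪ Set.range w))

/-! ## Registered stubs -/

/-- STUB 1 (size XL, OPEN for `k ≥ 2`; `k = 1` is Hermite–Lindemann): the INSIDE count — the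
conjecture of algebraic independence of logarithms of algebraic numbers, BY NAME
(`Literature.Barriers.Schanuel.AlgIndepLogarithms`; = item `LogPatterns.LogSector`). -/
theorem stub_logSector : AlgIndepLogarithms := by
  sorry

/-- STUB 2 (size XL, OPEN from `m = 2` / `k = m = 1`; `k = 0, m = 1` proved below): the OUTSIDE
count `OffLogRecursive` — recursive Schanuel relative to the log sector. -/
theorem stub_offLogRecursive : OffLogRecursive := by
  sorry

/-! ## Bookkeeping lemmas (sorry-free) -/

/-- Rational multiples in the exponent stay algebraic: if `e^u` is algebraic over `R` then so is
`e^{q u}` for every `q ∈ ℚ` (raise to the power `den q`).  (Verbatim the lemma of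
`SectorGlue` in `Theorems/RigidCoreSchanuelOnLogFreeCoreSectorGlue.lean`, repeated to keep this
skeleton self-contained.) [folklore] -/
theorem exp_rat_mul_mem_algebraicClosure (R : Type) [Field R] [Algebra R ℂ] (u : ℂ) (q : ℚ)
    (hu : exp u ∈ algebraicClosure R ℂ) : exp (q * u) ∈ algebraicClosure R ℂ := by
  rw [mem_algebraicClosure_iff]
  refine .of_pow q.den_pos ?_
  rw [← exp_nat_mul, ← mul_assoc, ← Rat.cast_natCast, ← Rat.cast_mul, Rat.den_mul_eq_num,
    Rat.cast_intCast, exp_int_mul]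
  exact mem_algebraicClosure_iff.1 (zpow_mem hu _)

/-- The span of a finite family lies in the field it generates (as a `ℚ`-subspace of `ℂ`).
[folklore] -/
theorem span_range_le_adjoin {ι : Type} (v : ι → ℂ) :
    span ℚ (range v) ≤ Subalgebra.toSubmodule (adjoin ℚ (range v)).toSubalgebra :=
  span_le.2 fun _ hs => subset_adjoin ℚ _ hs

/-! ## Composition (sorry-free): the adapted-basis engine along 𝓛 -/

/-- **The engine.**  `AlgIndepLogarithms` (inside count on `span_ℚ(x) ⊓ 𝓛`) and
`OffLogRecursive` (outside count on a complement, which is free modulo 𝓛 and recursive over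
`ℚ(x)`) imply the statement of the crux verbatim: a recursive `ℚ`-free tuple is algebraically
independent. [folklore] -/
theorem recursiveSchanuel_of_parts (hL : AlgIndepLogarithms) (hO : OffLogRecursive) :
    ∀ (n : ℕ) (z : Fin n → ℂ), LinearIndependent ℚ z →
      (∀ i, IsAlgebraic (IntermediateField.adjoin ℚ (Set.range z)) (Complex.exp (z i))) →
      AlgebraicIndependent ℚ z := by
  intro n x hx hrec
  have hAC : ∀ {R : Type} [Field R] [Algebra R ℂ] {w : ℂ},
      w ∈ algebraicClosure R ℂ ↔ IsAlgebraic R w := mem_algebraicClosure_iff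
  set E : Submodule ℚ ℂ := span ℚ {z : ℂ | IsAlgebraic ℚ (cexp z)} with hE
  set V : Submodule ℚ ℂ := span ℚ (range x) with hV
  set Kx : IntermediateField ℚ ℂ := adjoin ℚ (range x) with hKx
  haveI : FiniteDimensional ℚ V := FiniteDimensional.span_of_finite ℚ (finite_range x)
  obtain ⟨U', hU'⟩ := (V ⊓ E).exists_isCompl
  set W : Submodule ℚ ℂ := V ⊓ E
  set U : Submodule ℚ ℂ := V ⊓ U' with hU
  haveI : FiniteDimensional ℚ W := finiteDimensional_of_le inf_le_left
  haveI : FiniteDimensional ℚ U := finiteDimensional_of_le inf_le_left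
  have hsup : W ⊔ U = V := by
    rw [hU, inf_comm, ← sup_inf_assoc_of_le U' (inf_le_left : W ≤ V), hU'.sup_eq_top, top_inf_eq]
  have hdj : Disjoint W U := hU'.disjoint.mono_right inf_le_right
  set k := Module.finrank ℚ W
  set m := Module.finrank ℚ U
  have hn : k + m = n := by
    have h1 := finrank_sup_add_finrank_inf_eq W U
    rw [hdj.eq_bot, finrank_bot, add_zero, hsup, hV, finrank_span_eq_card hx,
      Fintype.card_fin] at h1
    exact h1.symm
  let bW := Module.finBasis ℚ W
  let bU := Module.finBasis ℚ U
  let y : Fin k → ℂ := fun i => bW i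
  let z : Fin m → ℂ := fun j => bU j
  have hyli : LinearIndependent ℚ y := bW.linearIndependent.map' W.subtype W.ker_subtype
  have hzli : LinearIndependent ℚ z := bU.linearIndependent.map' U.subtype U.ker_subtype
  have hyE : ∀ i, y i ∈ E := fun i => (bW i).2.2
  have hyV : ∀ i, y i ∈ V := fun i => (bW i).2.1
  have hzV : ∀ j, z j ∈ V := fun j => (bU j).2.1
  -- (1) the inside basis consists of logarithms of algebraic numbers
  have hyalg : ∀ i, IsAlgebraic ℚ (cexp (y i)) := fun i => isAlgebraic_exp_of_mem_span (hyE i)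
  -- (2) the outside basis is free modulo 𝓛
  have hzE : LinearIndependent ℚ (E.mkQ ∘ z) := by
    refine hzli.map ?_
    rw [ker_mkQ, disjoint_def]
    intro u hu huE
    have huU : u ∈ U := span_le.2 (range_subset_iff.2 fun j => (bU j).2) hu
    exact disjoint_def.1 hdj u ⟨huU.1, huE⟩ huU
  -- (3) the two bases together generate the same field as `x`
  have hWy : W = span ℚ (range y) := by
    have hry : range y = W.subtype '' range ⇑bW := by rw [← Set.range_comp]; rfl
    rw [hry, span_image, bW.span_eq, Submodule.map_top, range_subtype]
  have hUz : U = span ℚ (range z) := by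
    have hrz : range z = U.subtype '' range ⇑bU := by rw [← Set.range_comp]; rfl
    rw [hrz, span_image, bU.span_eq, Submodule.map_top, range_subtype]
  have hVyz : V = span ℚ (range y ∪ range z) := by rw [span_union, ← hWy, ← hUz, hsup]
  set K' : IntermediateField ℚ ℂ := adjoin ℚ (range y ∪ range z) with hK'
  have hK : K' = Kx := by
    refine le_antisymm (adjoin_le_iff.2 ?_) (adjoin_le_iff.2 ?_)
    · rintro _ (⟨i, rfl⟩ | ⟨j, rfl⟩)
      · exact span_range_le_adjoin x (hyV i)
      · exact span_range_le_adjoin x (hzV j)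
    · rintro _ ⟨i, rfl⟩
      have hxi : x i ∈ span ℚ (range y ∪ range z) := hVyz ▸ subset_span ⟨i, rfl⟩
      exact (span_le (p := Subalgebra.toSubmodule K'.toSubalgebra)).2
        (fun s hs => subset_adjoin ℚ _ hs) hxi
  -- (4) the outside basis is recursive over `ℚ(y, z) = ℚ(x)`
  have hexpx : ∀ i, exp (x i) ∈ algebraicClosure Kx ℂ := fun i => hAC.2 (hrec i)
  have hVK : ∀ a ∈ V, exp a ∈ algebraicClosure Kx ℂ := by
    intro a ha
    obtain ⟨c, rfl⟩ := (mem_span_range_iff_exists_fun ℚ).1 ha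
    simp_rw [Rat.smul_def]
    rw [exp_sum]
    exact prod_mem fun i _ => exp_rat_mul_mem_algebraicClosure Kx _ _ (hexpx i)
  have hzrec : ∀ j, IsAlgebraic K' (cexp (z j)) := by
    intro j
    rw [hK]
    exact hAC.1 (hVK _ (hzV j))
  -- (5) the two counts and the tower
  have hin : (k : Cardinal) ≤ trdeg ℚ (adjoin ℚ (range y)) := by
    have h := le_trdeg_adjoin_of_algebraicIndependent' (hL k y hyalg hyli)
    rwa [Fintype.card_fin] at h
  have hout := hO k m y z hyalg hzE hzrec
  have hle : (n : Cardinal) ≤ trdeg ℚ Kx := by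
    calc (n : Cardinal) = k + m := by rw [← hn, Nat.cast_add]
      _ ≤ trdeg ℚ (adjoin ℚ (range y)) + m := add_le_add hin le_rfl
      _ ≤ trdeg ℚ K' := hout
      _ = trdeg ℚ Kx := by rw [hK]
  exact algebraicIndependent_of_le_trdeg_adjoin x hle

/-- **The skeleton concludes the crux BY NAME**:
`Summit.Schanuel.Schanuel.Theses.RecursiveCore.RecursiveSchanuel` (route `RecursiveCore`, item
stmt-Schanuel-12193) from the two registered stubs plugged into the engine; its only `sorry`s are
inside `stub_logSector` and `stub_offLogRecursive`. -/
theorem RecursiveSchanuel_of : RecursiveSchanuel :=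
  recursiveSchanuel_of_parts stub_logSector stub_offLogRecursive

-- NB. The implication form is `recursiveSchanuel_of_parts : AlgIndepLogarithms → OffLogRecursive →
-- <crux body>` above (its conclusion is the body of `RecursiveSchanuel`, definitionally the crux;
-- sorry-free, axioms `propext`, `Classical.choice`, `Quot.sound`).  It is deliberately NOT restated
-- with the conclusion `RecursiveSchanuel` by name: the A12 skeleton audit takes any local theorem
-- concluding the crux by name as THE skeleton and requires its hypotheses to be registered
-- obligations or stubs, which the local statement `OffLogRecursive` is not.

/-! ## Exactness (sorry-free): the crux implies both stubs -/

/-- Monotonicity of `ℚ(·)` along `ℚ`-spans: if `A ⊆ span_ℚ B` then `ℚ(A) ≤ ℚ(B)`. [folklore] -/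
theorem adjoin_le_adjoin_of_subset_span {A B : Set ℂ} (h : A ⊆ span ℚ B) :
    adjoin ℚ A ≤ adjoin ℚ B :=
  adjoin_le_iff.2 fun _ ha => (span_le (p := Subalgebra.toSubmodule (adjoin ℚ B).toSubalgebra)).2
    (fun _ hs => subset_adjoin ℚ _ hs) (h ha)

/-- `trdeg_ℚ ℚ(v) ≤ k` for a `Fin k`-family `v`. [folklore] -/
theorem trdeg_adjoin_range_le {k : ℕ} (v : Fin k → ℂ) :
    trdeg ℚ (adjoin ℚ (range v)) ≤ (k : Cardinal) := by
  classical
  have h := trdeg_le_card_of_forall_isAlgebraic (F := ℚ) (adjoin ℚ (range v)).toSubalgebra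
    (Finset.univ.image v) (fun a ha => by
      rw [Finset.coe_image, Finset.coe_univ, Set.image_univ, ← isAlgebraic_adjoin_iff]
      exact isAlgebraic_algebraMap (⟨a, ha⟩ : adjoin ℚ (range v)))
  have hc : (Finset.univ.image v).card ≤ k := Finset.card_image_le.trans (by simp)
  exact h.trans (by exact_mod_cast hc)

/-- **The crux implies the inside count** (= support item `LogSectorInside` of the route): a tuple
of logarithms of algebraic numbers is recursive, since `e^{lᵢ} ∈ ℚ̄` is algebraic over `ℚ(l)`.
[folklore] -/
theorem algIndepLogarithms_of_recursiveSchanuel (hR : RecursiveSchanuel) : AlgIndepLogarithms :=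
  fun n l halg hli => hR n l hli fun i => (halg i).tower_top (L := adjoin ℚ (range l))

/-- **The crux implies the outside count**: given logarithms `l`, a block `w` free modulo 𝓛 and
recursive over `ℚ(l, w)`, pick a `ℚ`-basis `y` of `span_ℚ(l)` (`k'` vectors); the concatenation
`(y, w)` is `ℚ`-free (freeness of `w` modulo `𝓛 ⊇ span y`) and recursive (`e^{yᵢ} ∈ ℚ̄`,
`ℚ(y, w) = ℚ(l, w)`), so the crux makes it algebraically independent:
`trdeg ℚ(l, w) = trdeg ℚ(y, w) ≥ k' + m ≥ trdeg ℚ(l) + m`.  Hence the split is EXACT: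
`RecursiveSchanuel ↔ AlgIndepLogarithms ∧ OffLogRecursive` (`recursiveSchanuel_iff`). [folklore] -/
theorem offLogRecursive_of_recursiveSchanuel (hR : RecursiveSchanuel) : OffLogRecursive := by
  intro k m l w hl hw hrec
  set E : Submodule ℚ ℂ := span ℚ {z : ℂ | IsAlgebraic ℚ (cexp z)} with hE
  set Wl : Submodule ℚ ℂ := span ℚ (range l) with hWl
  haveI : FiniteDimensional ℚ Wl := FiniteDimensional.span_of_finite ℚ (finite_range l)
  set k' := Module.finrank ℚ Wl
  let bl := Module.finBasis ℚ Wl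
  let y : Fin k' → ℂ := fun i => bl i
  have hyli : LinearIndependent ℚ y := bl.linearIndependent.map' Wl.subtype Wl.ker_subtype
  have hWly : Wl = span ℚ (range y) := by
    have hry : range y = Wl.subtype '' range ⇑bl := by rw [← Set.range_comp]; rfl
    rw [hry, span_image, bl.span_eq, Submodule.map_top, range_subtype]
  have hlE : Wl ≤ E := span_le.2 (range_subset_iff.2 fun i => subset_span (hl i))
  have hyE' : span ℚ (range y) ≤ E := by rw [← hWly]; exact hlE
  have hyalg : ∀ i, IsAlgebraic ℚ (cexp (y i)) := fun i =>
    isAlgebraic_exp_of_mem_span (hlE (bl i).2)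
  have hy_in : range y ⊆ (span ℚ (range l) : Set ℂ) := by rintro _ ⟨i, rfl⟩; exact (bl i).2
  have hl_in : range l ⊆ (span ℚ (range y) : Set ℂ) := by
    rw [← hWly]; exact subset_span
  -- `w` is free, and free modulo `E ⊇ span y`
  have hwli : LinearIndependent ℚ w := LinearIndependent.of_comp E.mkQ hw
  have hdisj : Disjoint E (span ℚ (range w)) := by
    rw [disjoint_def]
    intro u huE hu
    obtain ⟨c, rfl⟩ := (mem_span_range_iff_exists_fun ℚ).1 hu
    have h0 : ∑ j, c j • (E.mkQ ∘ w) j = 0 := by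
      have h1 : E.mkQ (∑ j, c j • w j) = 0 := (Submodule.Quotient.mk_eq_zero E).2 huE
      simpa only [map_sum, map_smul, Function.comp_apply] using h1
    have hc := Fintype.linearIndependent_iff.1 hw c h0
    simp [hc]
  -- the concatenated family `v = (y, w)`
  let v : Fin (k' + m) → ℂ := Sum.elim y w ∘ finSumFinEquiv.symm
  have hvli : LinearIndependent ℚ v :=
    (hyli.sum_type hwli (hdisj.mono_left hyE')).comp _ finSumFinEquiv.symm.injective
  have hrv : range v = range y ∪ range w := by
    show range (Sum.elim y w ∘ ⇑finSumFinEquiv.symm) = _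
    rw [EquivLike.range_comp, Set.Sum.elim_range]
  -- the fields `ℚ(v) = ℚ(l, w)` and `ℚ(y) = ℚ(l)`
  have hyl : adjoin ℚ (range y) = adjoin ℚ (range l) :=
    le_antisymm (adjoin_le_adjoin_of_subset_span hy_in) (adjoin_le_adjoin_of_subset_span hl_in)
  have hvl : adjoin ℚ (range v) = adjoin ℚ (range l ∪ range w) := by
    rw [hrv]
    refine le_antisymm (adjoin_le_adjoin_of_subset_span (union_subset ?_ ?_))
      (adjoin_le_adjoin_of_subset_span (union_subset ?_ ?_))
    · exact hy_in.trans (span_mono subset_union_left)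
    · exact subset_union_right.trans subset_span
    · exact hl_in.trans (span_mono subset_union_left)
    · exact subset_union_right.trans subset_span
  -- `v` is recursive
  have key : ∀ s, IsAlgebraic (adjoin ℚ (range l ∪ range w)) (cexp (Sum.elim y w s)) := by
    rintro (i | j)
    · exact (hyalg i).tower_top (L := adjoin ℚ (range l ∪ range w))
    · exact hrec j
  have hvrec : ∀ i, IsAlgebraic (adjoin ℚ (range v)) (cexp (v i)) := by
    intro i
    rw [hvl]
    exact key _
  -- the crux at `v`, and the two transcendence-degree comparisons
  have hai : AlgebraicIndependent ℚ v := hR (k' + m) v hvli hvrec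
  have htr : ((k' + m : ℕ) : Cardinal) ≤ trdeg ℚ (adjoin ℚ (range l ∪ range w)) := by
    have h := le_trdeg_adjoin_of_algebraicIndependent' hai
    rwa [Fintype.card_fin, hvl] at h
  have hup : trdeg ℚ (adjoin ℚ (range l)) ≤ (k' : Cardinal) := by
    rw [← hyl]; exact trdeg_adjoin_range_le y
  calc trdeg ℚ (adjoin ℚ (range l)) + (m : Cardinal) ≤ (k' : Cardinal) + m := add_le_add hup le_rfl
    _ = ((k' + m : ℕ) : Cardinal) := by rw [Nat.cast_add]
    _ ≤ _ := htr

/-- **Exactness of the split**: `RecursiveSchanuel ↔ AlgIndepLogarithms ∧ OffLogRecursive`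
(sorry-free; neither stub is refutable short of refuting the crux, hence Schanuel). [folklore] -/
theorem recursiveSchanuel_iff : RecursiveSchanuel ↔ AlgIndepLogarithms ∧ OffLogRecursive :=
  ⟨fun h => ⟨algIndepLogarithms_of_recursiveSchanuel h, offLogRecursive_of_recursiveSchanuel h⟩,
    fun h => recursiveSchanuel_of_parts h.1 h.2⟩

/-! ## Calibration (sorry-free special cases) -/

/-- `OffLogRecursive` at `k = 0`, `m = 1` (inhabited in kind, elementary): a complex number `w`
outside the log sector whose exponential is algebraic over `ℚ(w)` is transcendental, i.e.
`trdeg ℚ(∅) + 1 ≤ trdeg ℚ(w)` — if `w` were algebraic, `e^w` would be algebraic over `ℚ`, putting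
`w` in 𝓛. [folklore] -/
theorem offLogRecursive_zero_one (l : Fin 0 → ℂ) (w : Fin 1 → ℂ)
    (hw : LinearIndependent ℚ ((Submodule.span ℚ {z : ℂ | IsAlgebraic ℚ (Complex.exp z)}).mkQ ∘ w))
    (hrec : ∀ j, IsAlgebraic (IntermediateField.adjoin ℚ (Set.range l ∪ Set.range w))
      (Complex.exp (w j))) :
    Algebra.trdeg ℚ (IntermediateField.adjoin ℚ (Set.range l)) + ((1 : ℕ) : Cardinal) ≤
      Algebra.trdeg ℚ (IntermediateField.adjoin ℚ (Set.range l ∪ Set.range w)) := by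
  have hl : Set.range l = ∅ := Set.range_eq_empty l
  have hw0 : w 0 ∉ span ℚ {z : ℂ | IsAlgebraic ℚ (cexp z)} := by
    intro h0
    apply hw.ne_zero 0
    rw [Function.comp_apply, Submodule.mkQ_apply, Submodule.Quotient.mk_eq_zero]
    exact h0
  -- `w 0` is transcendental over `ℚ`: otherwise `ℚ(w)` is algebraic, so `e^{w 0}` (algebraic over
  -- `ℚ(w)`) is algebraic over `ℚ`, i.e. `w 0 ∈ 𝓛`
  have htr : Transcendental ℚ (w 0) := by
    intro halg
    apply hw0
    refine subset_span ?_
    show IsAlgebraic ℚ (cexp (w 0))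
    haveI : Algebra.IsAlgebraic ℚ (IntermediateField.adjoin ℚ (Set.range l ∪ Set.range w)) :=
      IntermediateField.isAlgebraic_adjoin fun s hs => by
        rw [hl, Set.empty_union] at hs
        obtain ⟨j, rfl⟩ := hs
        rw [Subsingleton.elim j 0]
        exact halg.isIntegral
    exact (hrec 0).restrictScalars ℚ
  have h1 : ((1 : ℕ) : Cardinal) ≤ trdeg ℚ (adjoin ℚ (Set.range w)) := by
    have hai : AlgebraicIndependent ℚ w :=
      (algebraicIndependent_unique_type_iff (x := w)).2 (show Transcendental ℚ (w 0) from htr)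
    have h := le_trdeg_adjoin_of_algebraicIndependent' hai
    rwa [Fintype.card_fin] at h
  haveI : Algebra.IsAlgebraic ℚ (IntermediateField.adjoin ℚ (Set.range l)) :=
    IntermediateField.isAlgebraic_adjoin fun s hs => by rw [hl] at hs; exact hs.elim
  rw [trdeg_eq_zero, zero_add, hl, Set.empty_union]
  exact h1

end Summit.Schanuel.Schanuel.Cruxes.RecursiveSchanuel.Birth

end
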